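import Summits.CriticalPhenomena.PercolationContinuityZ3.Theorems.PercNearOneGluingNoHeavyLowerTailKnQuestion8CoefficientwiseCoreClassKernelMixBundleBoundaryIET
import HarnessLib

/-!
# CONJECTURE IET(Θ) settled for every bundle with a unit thread: `Θ(1, ℓ, m)`, ALL monotone real levels, ALL up-closed events

Support file (`--supports stmt-CriticalPhenomena-4575`, closed), prover `prim-cplus-coupling` (gen 48).  No definitions, no notations, no named facts,
no sorries; standard axioms.  Memo `prim-cplus-coupling/A5-COUPLING-gen48.md` §1.

On an explicit bundle whose threads are exactly `p`, `q` and a third thread `t₀` OF LENGTH ONE (the edge `u b` itself), i.e. the graphs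
`Θ(1, ℓ, m)` = a cycle through `u, b` plus the chord `u b`, the increasing-event-transfer functional
  `Σ_{ω ∈ 𝒱, b ∈ X∖Y} h(X) k(X) + Σ_{ω ∈ 𝒱, b ∈ Y∖X} (hᵃX − hᵇY)(kᵃX − kᵇY)`   (`X = C_u(ω)`, `Y = C_u(E∖ω)`)
is nonnegative for EVERY up-closed `𝒱` and ALL monotone real levels `0 ≤ hᵃ, hᵇ ≤ h`, `0 ≤ kᵃ, kᵇ ≤ k` — no thread support, no additivity, no regime.
PROOF.  Every demand colouring (`b ∈ Y ∖ X`) has the chord blue (a red chord puts `b ∈ X`), so the demand sum IS the boundary demand sum of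
`iet_boundary_bundle` (demand restricted to `ω ⊆ A p ∪ A q`); the supply sum dominates the boundary supply sum termwise because every supply
term `h(X) k(X)` is `≥ 0`.  Hence the full functional is `≥` the boundary functional `≥ 0` (THEOREM BI, `bundle_boundary_count`, all levels).
This is the first family of 2-connected graphs beyond cycles (`iet_cycle`) on which CONJECTURE IET is known for all monotone levels.
[cite: KozmaNitzan2024, Questions 8–9 (§5.5 p. 36) (context); Harris 1960]
-/

namespace Summit.CriticalPhenomena.PercolationContinuityZ3.Theorems

open Finset Literature.Probability.Percolation

namespace Coefficientwise

variable {ι V : Type*}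

open Classical in
/-- **IET on every bundle `Θ(1, ℓ, m)` (all monotone real levels, all up-closed events).**  On an explicit bundle whose threads are exactly
`p ≠ q` and a unit thread `t₀` (`L t₀ = 1`), the increasing-event-transfer functional over every up-closed event is nonnegative for all
monotone real levels `0 ≤ hᵃ, hᵇ ≤ h`, `0 ≤ kᵃ, kᵇ ≤ k`.  See the module docstring.
[cite: KozmaNitzan2024, Questions 8–9 (§5.5 p. 36) (context); Harris 1960] -/
theorem iet_bundle_unitThread (ends : ι → Sym2 V) (r : ℕ) (L : ℕ → ℕ) (hL : ∀ t, t < r → 1 ≤ L t)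
    (w : ℕ → ℕ → V) (e : ℕ → ℕ → ι) (u b : V)
    (hw0 : ∀ t, t < r → w t 0 = u) (hwL : ∀ t, t < r → w t (L t) = b)
    (harc : ∀ t, t < r → ∀ j, 1 ≤ j → j ≤ L t → ends (e t j) = s(w t (j - 1), w t j))
    (hwinj : ∀ t, t < r → ∀ i j, i ≤ L t → j ≤ L t → w t i = w t j → i = j)
    (hcross : ∀ t t', t < r → t' < r → t ≠ t' → ∀ i j, i ≤ L t → j ≤ L t' → w t i = w t' j → (i = 0 ∧ j = 0) ∨ (i = L t ∧ j = L t'))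
    (A : ℕ → Finset ι) (hA : ∀ t, t < r → ∀ i, i ∈ A t ↔ ∃ j, 1 ≤ j ∧ j ≤ L t ∧ e t j = i)
    (hAdisj : ∀ t t', t < r → t' < r → t ≠ t' → Disjoint (A t) (A t'))
    (E : Finset ι) (hEA : ∀ i, i ∈ E ↔ ∃ t, t < r ∧ i ∈ A t)
    (p q : ℕ) (hp : p < r) (hq : q < r) (hpq : p ≠ q) (t₀ : ℕ) (ht₀ : t₀ < r) (ht₀p : t₀ ≠ p) (ht₀q : t₀ ≠ q)
    (hunit : L t₀ = 1) (hthree : ∀ t, t < r → t = p ∨ t = q ∨ t = t₀)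
    (𝒱 : Finset ι → Prop) (hV : ∀ ⦃s t : Finset ι⦄, s ⊆ t → 𝒱 s → 𝒱 t)
    (h k ha hb ka kb : Set V → ℝ) (mh : Monotone h) (mk : Monotone k)
    (mha : Monotone ha) (mhb : Monotone hb) (mka : Monotone ka) (mkb : Monotone kb)
    (ha0 : ∀ S, 0 ≤ ha S) (hah : ∀ S, ha S ≤ h S) (hb0 : ∀ S, 0 ≤ hb S) (hbh : ∀ S, hb S ≤ h S)
    (ka0 : ∀ S, 0 ≤ ka S) (kak : ∀ S, ka S ≤ k S) (kb0 : ∀ S, 0 ≤ kb S) (kbk : ∀ S, kb S ≤ k S) :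
    0 ≤ (∑ ω ∈ E.powerset, if 𝒱 ω ∧ b ∈ openCluster (ends '' (↑ω : Set ι)) u ∧ b ∉ openCluster (ends '' (↑(E \ ω) : Set ι)) u then
        h (openCluster (ends '' (↑ω : Set ι)) u) * k (openCluster (ends '' (↑ω : Set ι)) u) else 0)
      + ∑ ω ∈ E.powerset, if 𝒱 ω ∧ b ∈ openCluster (ends '' (↑(E \ ω) : Set ι)) u ∧ b ∉ openCluster (ends '' (↑ω : Set ι)) u then
        (ha (openCluster (ends '' (↑ω : Set ι)) u) - hb (openCluster (ends '' (↑(E \ ω) : Set ι)) u)) *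
          (ka (openCluster (ends '' (↑ω : Set ι)) u) - kb (openCluster (ends '' (↑(E \ ω) : Set ι)) u)) else 0 := by
  set C : Finset ι → Set V := fun ω => openCluster (ends '' (↑ω : Set ι)) u with hC
  have bd := iet_boundary_bundle ends r L hL w e u b hw0 hwL harc hwinj hcross A hA hAdisj E hEA p q hp hq hpq t₀ ht₀ ht₀p ht₀q 𝒱 hV
    h k ha hb ka kb mh mk mha mhb mka mkb ha0 hah hb0 hbh ka0 kak kb0 kbk
  -- the chord: if `e t₀ 1 ∈ ω` then `b ∈ C ω`
  have chord : ∀ ω : Finset ι, e t₀ 1 ∈ ω → b ∈ C ω := by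
    intro ω he
    refine bundle_b_mem_cluster_of_full ends r L w e u b hw0 hwL harc ω t₀ ht₀ ?_
    intro j' hj1 hjL
    rw [hunit] at hjL
    obtain rfl : j' = 1 := le_antisymm hjL hj1
    exact he
  -- a colouring inside `E` avoiding the chord lies in `A p ∪ A q`
  have sub_pq : ∀ ω : Finset ι, ω ⊆ E → e t₀ 1 ∉ ω → ω ⊆ A p ∪ A q := by
    intro ω hω he i hi
    obtain ⟨t, ht, hit⟩ := (hEA i).mp (hω hi)
    rcases hthree t ht with rfl | rfl | rfl
    · exact Finset.mem_union_left _ hit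
    · exact Finset.mem_union_right _ hit
    · exfalso
      obtain ⟨j, hj1, hjL, hji⟩ := (hA t ht i).mp hit
      rw [hunit] at hjL
      obtain rfl : j = 1 := le_antisymm hjL hj1
      exact he (hji ▸ hi)
  -- ## termwise comparison
  have hk0 : ∀ S, 0 ≤ h S := fun S => (ha0 S).trans (hah S)
  have kk0 : ∀ S, 0 ≤ k S := fun S => (ka0 S).trans (kak S)
  refine le_trans bd (add_le_add ?_ ?_)
  · refine Finset.sum_le_sum fun ω _ => ?_
    by_cases h1 : (𝒱 ω ∧ E \ (A p ∪ A q) ⊆ ω) ∧ (b ∈ C ω ∧ b ∉ C (E \ ω))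
    · have h2 : 𝒱 ω ∧ b ∈ C ω ∧ b ∉ C (E \ ω) := ⟨h1.1.1, h1.2.1, h1.2.2⟩
      rw [if_pos h1, if_pos h2]
    · rw [if_neg h1]
      by_cases h2 : 𝒱 ω ∧ b ∈ C ω ∧ b ∉ C (E \ ω)
      · rw [if_pos h2]; exact mul_nonneg (hk0 _) (kk0 _)
      · rw [if_neg h2]
  · refine le_of_eq (Finset.sum_congr rfl fun ω hω => ?_)
    have hωE : ω ⊆ E := Finset.mem_powerset.mp hω
    have iff : ((𝒱 ω ∧ ω ⊆ A p ∪ A q) ∧ (b ∈ C (E \ ω) ∧ b ∉ C ω)) ↔ (𝒱 ω ∧ b ∈ C (E \ ω) ∧ b ∉ C ω) := by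
      constructor
      · rintro ⟨⟨hv, -⟩, hb1, hb2⟩; exact ⟨hv, hb1, hb2⟩
      · rintro ⟨hv, hb1, hb2⟩
        exact ⟨⟨hv, sub_pq ω hωE fun he => hb2 (chord ω he)⟩, hb1, hb2⟩
    by_cases h1 : (𝒱 ω ∧ ω ⊆ A p ∪ A q) ∧ (b ∈ C (E \ ω) ∧ b ∉ C ω)
    · rw [if_pos h1, if_pos (iff.mp h1)]
    · rw [if_neg h1, if_neg (fun h2 => h1 (iff.mpr h2))]

end Coefficientwise

end Summit.CriticalPhenomena.PercolationContinuityZ3.Theorems
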